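import Mathlib
import HarnessLib
import Literature.Analysis.FluidPDE.SuitableWeak
import Literature.Analysis.FluidPDE.LocalTypeI
import Literature.Analysis.FluidPDE.LocalTypeIProofs
import Literature.Analysis.FluidPDE.LocalTypeIScaling
import Literature.Analysis.FluidPDE.SpaceTimeRescaling
import Literature.Analysis.FluidPDE.PineauVicolOneSlicePressure
import Literature.Analysis.FluidPDE.EnstrophyGronwall
import Literature.Analysis.FluidPDE.SelfSimilar

/-!
# StableStrataDoorSingularProfileTools — the scale-invariant quantities `A`, `E`, `D` of a decaying profile at the apex
# (tools for SEED-26 input I1b `StableStrataDoorOneSliceDefs.SingularProfileFloor`, door S26 «StableStrataDoor»)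

Pure measure-theoretic bookkeeping (theorems only) for fields on the open past `(−∞,0) × ℝ³` with scale-invariant pointwise
majorants, at the backward cylinders `Q(r) = (−r², 0) × B_r` at the origin and at EVERY scale `r > 0`:

* `cknAEss_ne_top_of_hasTypeIDecay` — `A(r) < ∞` for a field with the Type-I envelope `‖v(t,x)‖ ≤ D/(‖x‖+√(−t))`
  (slices `≤ D² |x|⁻²`, integrable on balls of `ℝ³`);
* `cknE_ne_top_of_gradient_decay` — `E(r) < ∞` for a gradient with `‖G(t,x)‖ ≤ K/(‖x‖+√(−t))²`
  (`|G|²_F ≤ 3‖G‖² ≤ 3K² (‖x‖+√(−t))⁻⁴ ≤ 3K² |x|^{−5/2} (−t)^{−3/4}`, a separated integrable majorant);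
* `cknD_le_of_sq_decay` — the UNIFORM level `D(ρ) ≤ K^{3/2} ∬_{Q(1)} (‖x‖+√(−t))⁻³` for a pressure with
  `|Q(t,x)| ≤ K/(‖x‖+√(−t))²`, from the pointwise majorant and the exact parabolic scaling of the model weight
  `∬_{Q(ρ)} (‖x‖+√(−t))⁻³ = ρ² ∬_{Q(1)} (‖x‖+√(−t))⁻³` (`lintegral_invCubeWeight_parabolicCylinder`, change of variables
  `setLIntegral_preimage_comp_stAffine`); the unit integral is finite (`lintegral_invCubeWeight_unit_lt_top`) by the tree's
  separated Type-I majorant `lintegral_typeI_cube_lt_top` (Pineau–Vicol 2026, proof of Prop. 9.5: `(√(−t)+|x|)⁻³ ≤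
  (−t)^{−1/4}|x|^{−5/2}`).

These are the three finiteness / level hypotheses of Seregin's cubic lower bound at a singular point
(`Literature…Seregin2020.exists_le_cknC_of_isBackwardSingularPoint`) for the Riesz-pressure pair of a Type-I door-class profile;
the consumer is `StableStrataDoorSingularProfileFloor.singularProfileFloor_holds`.  Door family of LADDER-NS N0 (door S26 / SEED-26,
`--supports stmt-NavierStokesRegularity-0056`, helper lane; nsreg-p6 g15).
WHAT THIS IS NOT: not NS regularity (Clay A); no route, no item; no Navier–Stokes content at all (majorants only).

References: L. Caffarelli, R. Kohn, L. Nirenberg, CPAM 35 (1982), §2 (the quantities `A, E, C, D`) [CaffarelliKohnNirenberg1982];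
F. Lin, CPAM 51 (1998), Def. 1 [Lin1998]; B. Pineau, V. Vicol, arXiv:2607.09619 (2026), proof of Prop. 9.5 [PineauVicol2026].
-/

noncomputable section

set_option linter.dupNamespace false

namespace Summit.NavierStokesRegularity.NavierStokesRegularity.Theorems.StableStrataDoorSingularProfileTools

open MeasureTheory Set Function Filter Topology TopologicalSpace Metric
open Literature.Analysis Literature.Analysis.FluidPDE
open Literature.Analysis.FluidPDE.SuitableCompactness (parabolicCylinder_zero mem_parabolicCylinder_zero)
open scoped NNReal ENNReal

/-! ### Two elementary finite integrals (the separated Type-I majorants at any scale) -/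

/-- `∫_{−a}^{0} (−t)^{−β} dt < ∞` for `a > 0`, `β < 1` (in `ℝ≥0∞` form; the unit-scale, `β = 1/4` case is the tree's
`lintegral_Ioo_neg_rpow_quarter_lt_top`). -/
theorem lintegral_Ioo_neg_rpow_lt_top {a β : ℝ} (ha : 0 < a) (hβ : β < 1) :
    ∫⁻ t in Ioo (-a) 0, ENNReal.ofReal ((-t) ^ (-β)) < ⊤ := by
  have h1 : IntegrableOn (fun s : ℝ => s ^ (-β)) (Ioo (0 : ℝ) a) volume := by
    rw [intervalIntegral.integrableOn_Ioo_rpow_iff ha]; linarith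
  have h2 : IntegrableOn (fun t : ℝ => (-t) ^ (-β)) (Ioo (-a) 0) volume := by
    have hpre : Neg.neg ⁻¹' Ioo (0 : ℝ) a = Ioo (-a) 0 := by
      ext t; simp only [mem_preimage, mem_Ioo]; constructor <;> intro h <;> constructor <;> linarith
    have := ((Measure.measurePreserving_neg (volume : Measure ℝ)).integrableOn_comp_preimage
      (Homeomorph.neg ℝ).measurableEmbedding).2 h1
    rwa [hpre] at this
  calc ∫⁻ t in Ioo (-a) 0, ENNReal.ofReal ((-t) ^ (-β))
      = ∫⁻ t in Ioo (-a) 0, ‖(-t) ^ (-β)‖ₑ := by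
        refine setLIntegral_congr_fun measurableSet_Ioo fun t ht => ?_
        rw [Real.enorm_eq_ofReal (Real.rpow_nonneg (by linarith [ht.2]) _)]
    _ < ⊤ := h2.2

/-- `∫_{B_r} |x|^{−α} dx < ∞` in `ℝ³` for `α < 3` (in `ℝ≥0∞` form; Mathlib `integrableOn_ball_of_norm_le_rpow`). -/
theorem lintegral_ball_norm_rpow_neg_lt_top (r : ℝ) {α : ℝ} (hα : α < 3) :
    ∫⁻ x in ball (0 : EuclideanSpace ℝ (Fin 3)) r, ENNReal.ofReal (‖x‖ ^ (-α)) < ⊤ := by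
  have h1 : IntegrableOn (fun x : EuclideanSpace ℝ (Fin 3) => ‖x‖ ^ (-α)) (ball 0 r) volume := by
    refine integrableOn_ball_of_norm_le_rpow (by rw [finrank_euclideanSpace_fin]; norm_num)
      (C := 1) (α := α) (by rw [finrank_euclideanSpace_fin]; exact_mod_cast hα)
      (Eventually.of_forall fun y => ?_) ?_
    · rw [Real.norm_of_nonneg (Real.rpow_nonneg (norm_nonneg _) _), one_mul]
    · exact (continuous_norm.measurable.pow_const _).aestronglyMeasurable
  calc ∫⁻ x in ball (0 : EuclideanSpace ℝ (Fin 3)) r, ENNReal.ofReal (‖x‖ ^ (-α))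
      = ∫⁻ x in ball (0 : EuclideanSpace ℝ (Fin 3)) r, ‖‖x‖ ^ (-α)‖ₑ :=
        lintegral_congr fun x => (Real.enorm_eq_ofReal (Real.rpow_nonneg (norm_nonneg _) _)).symm
    _ < ⊤ := h1.2

/-- The separated majorant integrates finitely over every backward cylinder at the origin:
`∬_{Q(r)} (−t)^{−β} |x|^{−α} < ∞` for `β < 1`, `α < 3`. -/
theorem lintegral_parabolicCylinder_sep_lt_top {r α β : ℝ} (hr : 0 < r) (hα : α < 3) (hβ : β < 1) :
    ∫⁻ z in parabolicCylinder r (0 : ℝ × EuclideanSpace ℝ (Fin 3)),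
      ENNReal.ofReal ((-z.1) ^ (-β)) * ENNReal.ofReal (‖z.2‖ ^ (-α)) < ⊤ := by
  have hmT : Measurable fun t : ℝ => ENNReal.ofReal ((-t) ^ (-β)) :=
    (measurable_neg.pow_const _).ennreal_ofReal
  have hmX : Measurable fun x : EuclideanSpace ℝ (Fin 3) => ENNReal.ofReal (‖x‖ ^ (-α)) :=
    (continuous_norm.measurable.pow_const _).ennreal_ofReal
  rw [parabolicCylinder_zero, Measure.volume_eq_prod, ← Measure.prod_restrict,
    lintegral_prod_mul hmT.aemeasurable hmX.aemeasurable]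
  exact ENNReal.mul_lt_top (lintegral_Ioo_neg_rpow_lt_top (by positivity) hβ)
    (lintegral_ball_norm_rpow_neg_lt_top r hα)

/-- a.e. on `ℝ × ℝ³` the space variable is nonzero. -/
theorem ae_snd_ne_zero : ∀ᵐ z ∂(volume : Measure (ℝ × EuclideanSpace ℝ (Fin 3))), z.2 ≠ 0 := by
  rw [ae_iff]
  have hset : {z : ℝ × EuclideanSpace ℝ (Fin 3) | ¬z.2 ≠ 0} =
      (univ : Set ℝ) ×ˢ {(0 : EuclideanSpace ℝ (Fin 3))} := by
    ext z; simp
  rw [hset, Measure.volume_eq_prod, Measure.prod_prod]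
  simp

/-! ### The model weight `(|x| + √(−t))⁻³`: finiteness at unit scale and parabolic scaling -/

/-- `∬_{Q(1)} (|x| + √(−t))⁻³ < ∞` — the tree's `lintegral_typeI_cube_lt_top` (Pineau–Vicol 2026, proof of Prop. 9.5:
`|u|³ ≤ C³(√(−t)+|x|)⁻³ ≤ C³ (−t)^{−1/4}|x|^{−5/2}`) applied to the unit field `(√(−t)+|x|)⁻¹ e`, `|e| = 1`, whose cube norm
IS the weight. -/
theorem lintegral_invCubeWeight_unit_lt_top :
    ∫⁻ z in parabolicCylinder 1 (0 : ℝ × EuclideanSpace ℝ (Fin 3)),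
      ENNReal.ofReal (((‖z.2‖ + Real.sqrt (-z.1)) ^ 3)⁻¹) < ⊤ := by
  set e : EuclideanSpace ℝ (Fin 3) := EuclideanSpace.single 0 1 with he
  have hne : ‖e‖ = 1 := by simp [he]
  set w : ℝ → EuclideanSpace ℝ (Fin 3) → EuclideanSpace ℝ (Fin 3) :=
    fun t x => (Real.sqrt (-t) + ‖x‖)⁻¹ • e with hw
  have hnorm : ∀ t x, ‖w t x‖ = (Real.sqrt (-t) + ‖x‖)⁻¹ := by
    intro t x
    simp only [hw]
    rw [norm_smul, hne, mul_one, Real.norm_of_nonneg (inv_nonneg.2 (by positivity))]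
  have hI : ∀ t ∈ Ico (-1 : ℝ) 0, ∀ x ∈ ball (0 : EuclideanSpace ℝ (Fin 3)) 1,
      ‖w t x‖ ≤ 1 / (Real.sqrt (-t) + ‖x‖) := fun t _ x _ => by rw [hnorm, one_div]
  have h := lintegral_typeI_cube_lt_top hI
  have hfun : (fun z : ℝ × EuclideanSpace ℝ (Fin 3) => ENNReal.ofReal (‖w z.1 z.2‖ ^ 3)) =
      fun z => ENNReal.ofReal (((‖z.2‖ + Real.sqrt (-z.1)) ^ 3)⁻¹) := by
    funext z; rw [hnorm, inv_pow, add_comm]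
  rw [hfun] at h
  rwa [parabolicCylinder_zero, one_pow]

/-- **Parabolic scaling of the model weight**: `∬_{Q(ρ)} (|x|+√(−t))⁻³ = ρ² ∬_{Q(1)} (|x|+√(−t))⁻³` (the dilation
`(s, y) ↦ (ρ² s, ρ y)` maps `Q(1)` onto `Q(ρ)` with Jacobian `ρ⁵`, and the weight is homogeneous of degree `−3`). -/
theorem lintegral_invCubeWeight_parabolicCylinder {ρ : ℝ} (hρ : 0 < ρ) :
    ∫⁻ z in parabolicCylinder ρ (0 : ℝ × EuclideanSpace ℝ (Fin 3)),
        ENNReal.ofReal (((‖z.2‖ + Real.sqrt (-z.1)) ^ 3)⁻¹) =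
      ENNReal.ofReal (ρ ^ 2) * ∫⁻ z in parabolicCylinder 1 (0 : ℝ × EuclideanSpace ℝ (Fin 3)),
        ENNReal.ofReal (((‖z.2‖ + Real.sqrt (-z.1)) ^ 3)⁻¹) := by
  set W : ℝ × EuclideanSpace ℝ (Fin 3) → ℝ≥0∞ :=
    fun z => ENNReal.ofReal (((‖z.2‖ + Real.sqrt (-z.1)) ^ 3)⁻¹) with hW
  have hρ2 : 0 < ρ ^ 2 := by positivity
  have hρ3 : 0 < ρ ^ 3 := by positivity
  have hρ5 : 0 < ρ ^ 2 * ρ ^ 3 := by positivity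
  -- the parabolic dilation `Φ(s, y) = (ρ² s, ρ y)` maps `Q(1)` onto `Q(ρ)`
  have h0 : stAffine (ρ ^ 2) ρ 0 (0 : EuclideanSpace ℝ (Fin 3)) (0 : ℝ × EuclideanSpace ℝ (Fin 3)) = 0 :=
    Prod.ext (by simp [stAffine_fst]) (by simp [stAffine_snd])
  have hpre : stAffine (ρ ^ 2) ρ 0 (0 : EuclideanSpace ℝ (Fin 3)) ⁻¹'
      parabolicCylinder ρ (0 : ℝ × EuclideanSpace ℝ (Fin 3)) =
        parabolicCylinder 1 (0 : ℝ × EuclideanSpace ℝ (Fin 3)) := by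
    have h := LocalTypeIScaling.stAffine_preimage_parabolicCylinder hρ 0 (0 : EuclideanSpace ℝ (Fin 3)) 1
      (0 : ℝ × EuclideanSpace ℝ (Fin 3))
    rwa [h0, mul_one] at h
  -- the weight is homogeneous of degree `−3`
  have hcomp : ∀ z : ℝ × EuclideanSpace ℝ (Fin 3),
      W (stAffine (ρ ^ 2) ρ 0 0 z) = (ENNReal.ofReal (ρ ^ 3))⁻¹ * W z := by
    intro z
    simp only [hW, stAffine_fst, stAffine_snd, zero_add]
    rw [norm_smul, Real.norm_of_nonneg hρ.le, show -(ρ ^ 2 * z.1) = ρ ^ 2 * (-z.1) by ring,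
      Real.sqrt_mul hρ2.le, Real.sqrt_sq hρ.le, ← mul_add, mul_pow, mul_inv,
      ENNReal.ofReal_mul (inv_nonneg.2 hρ3.le), ENNReal.ofReal_inv_of_pos hρ3]
  have hsub := setLIntegral_preimage_comp_stAffine (E := EuclideanSpace ℝ (Fin 3)) hρ2 hρ 0 0 W
    (parabolicCylinder ρ (0 : ℝ × EuclideanSpace ℝ (Fin 3)))
  rw [hpre, finrank_euclideanSpace_fin] at hsub
  simp_rw [hcomp] at hsub
  have hane : (ENNReal.ofReal (ρ ^ 3))⁻¹ ≠ ⊤ :=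
    ENNReal.inv_ne_top.2 (ENNReal.ofReal_pos.2 hρ3).ne'
  rw [lintegral_const_mul' _ _ hane] at hsub
  -- `hsub : (ρ³)⁻¹ I = (ρ⁵)⁻¹ X`; solve for `X`
  rw [ENNReal.ofReal_inv_of_pos hρ5] at hsub
  have hb0 : ENNReal.ofReal (ρ ^ 2 * ρ ^ 3) ≠ 0 := (ENNReal.ofReal_pos.2 hρ5).ne'
  have hbt : ENNReal.ofReal (ρ ^ 2 * ρ ^ 3) ≠ ⊤ := ENNReal.ofReal_ne_top
  change ∫⁻ z in parabolicCylinder ρ (0 : ℝ × EuclideanSpace ℝ (Fin 3)), W z =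
    ENNReal.ofReal (ρ ^ 2) * ∫⁻ z in parabolicCylinder 1 (0 : ℝ × EuclideanSpace ℝ (Fin 3)), W z
  calc ∫⁻ z in parabolicCylinder ρ (0 : ℝ × EuclideanSpace ℝ (Fin 3)), W z
      = ENNReal.ofReal (ρ ^ 2 * ρ ^ 3) * ((ENNReal.ofReal (ρ ^ 2 * ρ ^ 3))⁻¹ *
          ∫⁻ z in parabolicCylinder ρ (0 : ℝ × EuclideanSpace ℝ (Fin 3)), W z) := by
        rw [← mul_assoc, ENNReal.mul_inv_cancel hb0 hbt, one_mul]
    _ = ENNReal.ofReal (ρ ^ 2 * ρ ^ 3) * ((ENNReal.ofReal (ρ ^ 3))⁻¹ *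
          ∫⁻ z in parabolicCylinder 1 (0 : ℝ × EuclideanSpace ℝ (Fin 3)), W z) := by rw [hsub]
    _ = (ENNReal.ofReal (ρ ^ 2 * ρ ^ 3) / ENNReal.ofReal (ρ ^ 3)) *
          ∫⁻ z in parabolicCylinder 1 (0 : ℝ × EuclideanSpace ℝ (Fin 3)), W z := by
        rw [div_eq_mul_inv, mul_assoc]
    _ = ENNReal.ofReal (ρ ^ 2) * ∫⁻ z in parabolicCylinder 1 (0 : ℝ × EuclideanSpace ℝ (Fin 3)), W z := by
        rw [← ENNReal.ofReal_div_of_pos hρ3, mul_div_cancel_right₀ _ hρ3.ne']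

/-! ### The three scale-invariant quantities of a decaying profile: `D` bounded, `A` and `E` finite -/

/-- **Uniform bound of the scaled pressure quantity at every scale**: if `|Q(t,x)| ≤ K/(|x|+√(−t))²` on the past, then
`D(Q; ρ, 0) ≤ K^{3/2} ∬_{Q(1)} (|x|+√(−t))⁻³` for EVERY `ρ > 0` (pointwise majorant + the parabolic scaling of the weight). -/
theorem cknD_le_of_sq_decay {Q : ℝ → EuclideanSpace ℝ (Fin 3) → ℝ} {K : ℝ} (hK : 0 ≤ K)
    (hQ : ∀ t < (0 : ℝ), ∀ x : EuclideanSpace ℝ (Fin 3), |Q t x| ≤ K / (‖x‖ + Real.sqrt (-t)) ^ 2)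
    {ρ : ℝ} (hρ : 0 < ρ) :
    cknD ρ (0 : ℝ × EuclideanSpace ℝ (Fin 3)) Q ≤
      ENNReal.ofReal (K ^ (3 / 2 : ℝ)) * ∫⁻ z in parabolicCylinder 1 (0 : ℝ × EuclideanSpace ℝ (Fin 3)),
        ENNReal.ofReal (((‖z.2‖ + Real.sqrt (-z.1)) ^ 3)⁻¹) := by
  set W : ℝ × EuclideanSpace ℝ (Fin 3) → ℝ≥0∞ :=
    fun z => ENNReal.ofReal (((‖z.2‖ + Real.sqrt (-z.1)) ^ 3)⁻¹) with hW
  have hpt : ∀ z ∈ parabolicCylinder ρ (0 : ℝ × EuclideanSpace ℝ (Fin 3)),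
      ‖Q z.1 z.2‖ₑ ^ (3 / 2 : ℝ) ≤ ENNReal.ofReal (K ^ (3 / 2 : ℝ)) * W z := by
    intro z hz
    rw [mem_parabolicCylinder_zero] at hz
    have ht : z.1 < 0 := hz.1.2
    have hst : 0 < Real.sqrt (-z.1) := Real.sqrt_pos.2 (by linarith)
    have ha : 0 < ‖z.2‖ + Real.sqrt (-z.1) := by positivity
    have h1 := hQ z.1 ht z.2
    have h2 : |Q z.1 z.2| ^ (3 / 2 : ℝ) ≤ (K / (‖z.2‖ + Real.sqrt (-z.1)) ^ 2) ^ (3 / 2 : ℝ) :=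
      Real.rpow_le_rpow (abs_nonneg _) h1 (by norm_num)
    have h3 : (K / (‖z.2‖ + Real.sqrt (-z.1)) ^ 2) ^ (3 / 2 : ℝ) =
        K ^ (3 / 2 : ℝ) * ((‖z.2‖ + Real.sqrt (-z.1)) ^ 3)⁻¹ := by
      rw [Real.div_rpow hK (by positivity), div_eq_mul_inv]
      congr 2
      rw [← Real.rpow_natCast _ 2, ← Real.rpow_mul ha.le, ← Real.rpow_natCast _ 3]
      norm_num
    rw [Real.enorm_eq_ofReal_abs, ENNReal.ofReal_rpow_of_nonneg (abs_nonneg _) (by norm_num), hW]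
    dsimp only
    rw [← ENNReal.ofReal_mul (Real.rpow_nonneg hK _)]
    exact ENNReal.ofReal_le_ofReal (h2.trans h3.le)
  have hP0 : ENNReal.ofReal (ρ ^ 2) ≠ 0 := (ENNReal.ofReal_pos.2 (by positivity)).ne'
  have hPt : ENNReal.ofReal (ρ ^ 2) ≠ ⊤ := ENNReal.ofReal_ne_top
  unfold cknD
  calc (ENNReal.ofReal ρ ^ 2)⁻¹ *
        ∫⁻ q in parabolicCylinder ρ (0 : ℝ × EuclideanSpace ℝ (Fin 3)), ‖Q q.1 q.2‖ₑ ^ (3 / 2 : ℝ)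
      ≤ (ENNReal.ofReal ρ ^ 2)⁻¹ *
        ∫⁻ q in parabolicCylinder ρ (0 : ℝ × EuclideanSpace ℝ (Fin 3)), ENNReal.ofReal (K ^ (3 / 2 : ℝ)) * W q := by
        exact mul_le_mul' le_rfl (setLIntegral_mono' (isOpen_parabolicCylinder _ _).measurableSet hpt)
    _ = (ENNReal.ofReal (ρ ^ 2))⁻¹ * (ENNReal.ofReal (K ^ (3 / 2 : ℝ)) * (ENNReal.ofReal (ρ ^ 2) *
          ∫⁻ z in parabolicCylinder 1 (0 : ℝ × EuclideanSpace ℝ (Fin 3)), W z)) := by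
        rw [lintegral_const_mul' _ _ ENNReal.ofReal_ne_top, hW, lintegral_invCubeWeight_parabolicCylinder hρ,
          ENNReal.ofReal_pow hρ.le]
    _ = ENNReal.ofReal (K ^ (3 / 2 : ℝ)) *
          ∫⁻ z in parabolicCylinder 1 (0 : ℝ × EuclideanSpace ℝ (Fin 3)), W z := by
        rw [mul_left_comm (ENNReal.ofReal (K ^ (3 / 2 : ℝ))), ← mul_assoc, ← mul_assoc,
          ENNReal.inv_mul_cancel hP0 hPt, one_mul]

/-- **`A` is finite at every scale for a profile with the Type-I decay** `|v(t,x)| ≤ D/(|x|+√(−t))`: each slice has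
`∫_{B_r}|v(t)|² ≤ D² ∫_{B_r}|x|⁻² < ∞`, uniformly in `t`. -/
theorem cknAEss_ne_top_of_hasTypeIDecay {v : ℝ → EuclideanSpace ℝ (Fin 3) → EuclideanSpace ℝ (Fin 3)} {D : ℝ}
    (hD : 0 ≤ D) (hdec : HasTypeIDecay D v) {r : ℝ} (hr : 0 < r) :
    cknAEss r (0 : ℝ × EuclideanSpace ℝ (Fin 3)) v ≠ ⊤ := by
  -- the slice majorant `D² |x|^{-2}` on the ball
  set J : ℝ≥0∞ := ∫⁻ x in ball (0 : EuclideanSpace ℝ (Fin 3)) r,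
    ENNReal.ofReal (D ^ 2) * ENNReal.ofReal (‖x‖ ^ (-(2 : ℝ))) with hJ
  have hJt : J < ⊤ := by
    rw [hJ, lintegral_const_mul' _ _ ENNReal.ofReal_ne_top]
    exact ENNReal.mul_lt_top ENNReal.ofReal_lt_top (lintegral_ball_norm_rpow_neg_lt_top r (by norm_num))
  have h0 : ∀ᵐ x ∂(volume.restrict (ball (0 : EuclideanSpace ℝ (Fin 3)) r)), x ≠ 0 := by
    refine ae_restrict_of_ae ?_
    rw [ae_iff]
    have hset : {x : EuclideanSpace ℝ (Fin 3) | ¬x ≠ 0} = {0} := by ext x; simp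
    rw [hset, measure_singleton]
  have hslice : ∀ t < (0 : ℝ), ∫⁻ x in ball (0 : EuclideanSpace ℝ (Fin 3)) r, ‖v t x‖ₑ ^ 2 ≤ J := by
    intro t ht
    refine lintegral_mono_ae ?_
    filter_upwards [h0] with x hx
    have hxpos : 0 < ‖x‖ := norm_pos_iff.2 hx
    have h1 : ‖v t x‖ ≤ D / ‖x‖ :=
      (hdec t ht x).trans (div_le_div_of_nonneg_left hD hxpos (le_add_of_nonneg_right (Real.sqrt_nonneg _)))
    have h2 : ‖v t x‖ ^ 2 ≤ D ^ 2 * ‖x‖ ^ (-(2 : ℝ)) := by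
      rw [Real.rpow_neg (norm_nonneg _), Real.rpow_two]
      calc ‖v t x‖ ^ 2 ≤ (D / ‖x‖) ^ 2 := pow_le_pow_left₀ (norm_nonneg _) h1 2
        _ = D ^ 2 * (‖x‖ ^ 2)⁻¹ := by rw [div_pow, div_eq_mul_inv]
    calc ‖v t x‖ₑ ^ 2 = ENNReal.ofReal (‖v t x‖ ^ 2) := by
          rw [← ofReal_norm, ENNReal.ofReal_pow (norm_nonneg _)]
      _ ≤ ENNReal.ofReal (D ^ 2 * ‖x‖ ^ (-(2 : ℝ))) := ENNReal.ofReal_le_ofReal h2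
      _ = ENNReal.ofReal (D ^ 2) * ENNReal.ofReal (‖x‖ ^ (-(2 : ℝ))) := ENNReal.ofReal_mul (sq_nonneg _)
  rw [cknAEss, Prod.fst_zero, Prod.snd_zero, zero_sub]
  have hle : essSup (fun t => (ENNReal.ofReal r)⁻¹ * ∫⁻ x in ball (0 : EuclideanSpace ℝ (Fin 3)) r, ‖v t x‖ₑ ^ 2)
      (volume.restrict (Ioo (-r ^ 2) 0)) ≤ (ENNReal.ofReal r)⁻¹ * J := by
    refine essSup_le_of_ae_le _ ?_
    filter_upwards [ae_restrict_mem measurableSet_Ioo] with t ht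
    exact mul_le_mul' le_rfl (hslice t ht.2)
  refine ne_top_of_le_ne_top ?_ hle
  exact ENNReal.mul_ne_top (ENNReal.inv_ne_top.2 (ENNReal.ofReal_pos.2 hr).ne') hJt.ne

/-- `((a + b)⁴)⁻¹ ≤ a^{−5/2} b^{−3/2}` for `a, b > 0`. -/
theorem inv_add_pow_four_le_rpow (a b : ℝ) (ha : 0 < a) (hb : 0 < b) :
    ((a + b) ^ 4)⁻¹ ≤ a ^ (-(5 / 2 : ℝ)) * b ^ (-(3 / 2 : ℝ)) := by
  have hab : 0 < a + b := by positivity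
  have h1 : a ^ (5 / 2 : ℝ) ≤ (a + b) ^ (5 / 2 : ℝ) :=
    Real.rpow_le_rpow ha.le (by linarith) (by norm_num)
  have h2 : b ^ (3 / 2 : ℝ) ≤ (a + b) ^ (3 / 2 : ℝ) :=
    Real.rpow_le_rpow hb.le (by linarith) (by norm_num)
  have h3 : a ^ (5 / 2 : ℝ) * b ^ (3 / 2 : ℝ) ≤ (a + b) ^ 4 := by
    calc a ^ (5 / 2 : ℝ) * b ^ (3 / 2 : ℝ) ≤ (a + b) ^ (5 / 2 : ℝ) * (a + b) ^ (3 / 2 : ℝ) :=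
          mul_le_mul h1 h2 (by positivity) (by positivity)
      _ = (a + b) ^ ((5 / 2 : ℝ) + 3 / 2) := (Real.rpow_add hab _ _).symm
      _ = (a + b) ^ 4 := by norm_num
  have h4 : 0 < a ^ (5 / 2 : ℝ) * b ^ (3 / 2 : ℝ) := by positivity
  rw [Real.rpow_neg ha.le, Real.rpow_neg hb.le, ← mul_inv]
  exact inv_anti₀ h4 h3

/-- **`E` is finite at every scale for a gradient with the scale-invariant decay** `‖G(t,x)‖ ≤ K/(|x|+√(−t))²`:
`|G|²_F ≤ 3‖G‖² ≤ 3K² (|x|+√(−t))⁻⁴ ≤ 3K² |x|^{−5/2} (−t)^{−3/4}`, a separated integrable majorant. -/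
theorem cknE_ne_top_of_gradient_decay
    {G : ℝ → EuclideanSpace ℝ (Fin 3) → EuclideanSpace ℝ (Fin 3) →L[ℝ] EuclideanSpace ℝ (Fin 3)} {K : ℝ}
    (hG : ∀ t < (0 : ℝ), ∀ x : EuclideanSpace ℝ (Fin 3), ‖G t x‖ ≤ K / (‖x‖ + Real.sqrt (-t)) ^ 2)
    {r : ℝ} (hr : 0 < r) :
    cknE r (0 : ℝ × EuclideanSpace ℝ (Fin 3)) G ≠ ⊤ := by
  have hK : 0 ≤ K := by
    have h := (norm_nonneg _).trans (hG (-1) (by norm_num) 0)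
    rw [norm_zero, zero_add, neg_neg, Real.sqrt_one, one_pow, div_one] at h
    exact h
  -- pointwise separated majorant, a.e. on the cylinder (`x ≠ 0`)
  have hle : ∀ᵐ z ∂(volume.restrict (parabolicCylinder r (0 : ℝ × EuclideanSpace ℝ (Fin 3)))),
      ENNReal.ofReal (frobeniusNormSq (G z.1 z.2)) ≤
        ENNReal.ofReal (3 * K ^ 2) * (ENNReal.ofReal ((-z.1) ^ (-(3 / 4 : ℝ))) *
          ENNReal.ofReal (‖z.2‖ ^ (-(5 / 2 : ℝ)))) := by
    filter_upwards [ae_restrict_mem (isOpen_parabolicCylinder _ _).measurableSet,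
      ae_restrict_of_ae ae_snd_ne_zero] with z hz hz0
    rw [mem_parabolicCylinder_zero] at hz
    have ht : 0 < -z.1 := by linarith [hz.1.2]
    have hb : 0 < Real.sqrt (-z.1) := Real.sqrt_pos.2 ht
    have ha : 0 < ‖z.2‖ := norm_pos_iff.2 hz0
    have hab : 0 < ‖z.2‖ + Real.sqrt (-z.1) := by positivity
    have h1 : frobeniusNormSq (G z.1 z.2) ≤ 3 * K ^ 2 * ((‖z.2‖ + Real.sqrt (-z.1)) ^ 4)⁻¹ := by
      have hn := hG z.1 (by linarith) z.2
      have hn2 : ‖G z.1 z.2‖ ^ 2 ≤ (K / (‖z.2‖ + Real.sqrt (-z.1)) ^ 2) ^ 2 :=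
        pow_le_pow_left₀ (norm_nonneg _) hn 2
      calc frobeniusNormSq (G z.1 z.2) ≤ 3 * ‖G z.1 z.2‖ ^ 2 := frobeniusNormSq_le_three_mul _
        _ ≤ 3 * (K / (‖z.2‖ + Real.sqrt (-z.1)) ^ 2) ^ 2 := by gcongr
        _ = 3 * K ^ 2 * ((‖z.2‖ + Real.sqrt (-z.1)) ^ 4)⁻¹ := by
            rw [div_pow, ← pow_mul, div_eq_mul_inv]; ring
    have h2 : ((‖z.2‖ + Real.sqrt (-z.1)) ^ 4)⁻¹ ≤ ‖z.2‖ ^ (-(5 / 2 : ℝ)) * (-z.1) ^ (-(3 / 4 : ℝ)) := by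
      have h := inv_add_pow_four_le_rpow _ _ ha hb
      have h3 : Real.sqrt (-z.1) ^ (-(3 / 2 : ℝ)) = (-z.1) ^ (-(3 / 4 : ℝ)) := by
        rw [Real.sqrt_eq_rpow, ← Real.rpow_mul ht.le]; norm_num
      rwa [h3] at h
    have h3 : frobeniusNormSq (G z.1 z.2) ≤ 3 * K ^ 2 * ((-z.1) ^ (-(3 / 4 : ℝ)) * ‖z.2‖ ^ (-(5 / 2 : ℝ))) := by
      rw [mul_comm ((-z.1) ^ (-(3 / 4 : ℝ)))]
      exact h1.trans (mul_le_mul_of_nonneg_left h2 (by positivity))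
    rw [← ENNReal.ofReal_mul (Real.rpow_nonneg ht.le _), ← ENNReal.ofReal_mul (by positivity)]
    exact ENNReal.ofReal_le_ofReal h3
  have hmT : Measurable fun t : ℝ => ENNReal.ofReal ((-t) ^ (-(3 / 4 : ℝ))) :=
    (measurable_neg.pow_const _).ennreal_ofReal
  have hmX : Measurable fun x : EuclideanSpace ℝ (Fin 3) => ENNReal.ofReal (‖x‖ ^ (-(5 / 2 : ℝ))) :=
    (continuous_norm.measurable.pow_const _).ennreal_ofReal
  have hfin : ∫⁻ z in parabolicCylinder r (0 : ℝ × EuclideanSpace ℝ (Fin 3)),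
      ENNReal.ofReal (frobeniusNormSq (G z.1 z.2)) < ⊤ := by
    refine lt_of_le_of_lt (lintegral_mono_ae hle) ?_
    rw [lintegral_const_mul' _ _ ENNReal.ofReal_ne_top]
    exact ENNReal.mul_lt_top ENNReal.ofReal_lt_top
      (lintegral_parabolicCylinder_sep_lt_top hr (by norm_num) (by norm_num))
  rw [cknE]
  exact ENNReal.mul_ne_top (ENNReal.inv_ne_top.2 (ENNReal.ofReal_pos.2 hr).ne') hfin.ne

end Summit.NavierStokesRegularity.NavierStokesRegularity.Theorems.StableStrataDoorSingularProfileTools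

end
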